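import Literature.NumberTheory.Transcendental.KZFibredRelations
import Literature.NumberTheory.Transcendental.KZDominatedFamily
import Literature.NumberTheory.Transcendental.KZCalculusProofs
import Literature.NumberTheory.Transcendental.KZLogCalculusProofs
import Summits.KontsevichZagierPeriods.KontsevichZagierPeriods.Theses.ValuedFieldSpecialisation

/-!
# Route ValuedFieldSpecialisation — fibred-move toolkit for `ClassLevelExpansionFibreDimOne`

Helper lemmas (supports item stmt-KontsevichZagierPeriods-3503, `ClassLevelExpansionFibreDimOne`)
about the FIBRED relations `KZ.fibredRelations` (closure of the fibred move generators, verbatim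
the closure inlined in the item) and the dominated families `KZ.IsDominatedFamily` (verbatim the
dominated clause of the item):

* junk and congruence inside `fibredRelations`: a representation over a null domain, or with
  integrand vanishing on its domain, is a fibred relation; representations with the same domain
  and integrands agreeing on it are fibred-equivalent; restriction to a semialgebraic subdomain with
  null complement is a fibred move; splitting a domain into two semialgebraic pieces with null
  overlap is a fibred move;
* families whose domain avoids the slab `{0 < z 0 < ε}` are dominated (by the empty
  representation, with empty special fibre); in particular the complement `R|{z 0 ∉ (0, ε)}` of a
  slab restriction is dominated, so that modulo fibred moves and dominated families every family
  may be replaced by its restriction to `{0 < z 0 < ε}`, `ε` rational.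

Sources: M. Kontsevich, D. Zagier, *Periods* (2001), §1.2 (rules (1)–(3)); the fibred calculus is
this project's (route ValuedFieldSpecialisation). Deliberately NOT here: anything about the
elementary divergent product families (separate file) or about the analytic core of the item.
-/

noncomputable section

namespace Summit.KontsevichZagierPeriods.ValuedFieldSpecialisation

open MeasureTheory Set Filter
open scoped Topology
open Literature.NumberTheory.Transcendental Literature.NumberTheory.Transcendental.KZ
open Literature.ModelTheory.ExponentialFields (IsSemialgebraic)

variable {n : ℕ}

/-! ### Junk and congruence in the fibred calculus -/

/-- A representation over a Lebesgue-null domain is a FIBRED relation: domain additivity for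
`σ = σ ∪ σ` with null overlap `σ ∩ σ = σ` reads `[r] − [r] − [r] ∈ domainAddRel`, and every
domain-additivity instance is a fibred generator. [Kontsevich–Zagier 2001, §1.2, rule (1)]
[folklore] -/
theorem of_mem_fibredRelations_of_volume_eq_zero (r : IntegralRep n) (h : volume r.domain = 0) :
    of r ∈ fibredRelations := by
  have hgen : of r - of r - of r ∈ domainAddRel :=
    ⟨n, r, r, r, (union_self _).symm, by simpa using h, fun _ _ => rfl, fun _ _ => rfl, rfl⟩
  have := fibredRelations.neg_mem (mem_fibredRelations_of_mem_domainAddRel hgen)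
  simpa using this

/-- A representation whose integrand vanishes on its domain is a FIBRED relation: integrand
additivity `0 = 0 + 0` reads `[r] − [r] − [r] ∈ integrandAddRel`.
[Kontsevich–Zagier 2001, §1.2, rule (1)] [folklore] -/
theorem of_mem_fibredRelations_of_eqOn_zero (r : IntegralRep n) (h : EqOn r.integrand 0 r.domain) :
    of r ∈ fibredRelations := by
  have hgen : of r - of r - of r ∈ integrandAddRel :=
    ⟨n, r, r, r, rfl, rfl, fun x hx => by simp [h hx], rfl⟩
  have := fibredRelations.neg_mem (mem_fibredRelations_of_mem_integrandAddRel hgen)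
  simpa using this

/-- **Congruence in the fibred calculus**: two representations with the same domain whose
integrands agree ON the domain are fibred-equivalent (integrand additivity with a zero
representation, which is itself a fibred relation). [Kontsevich–Zagier 2001, §1.2, rule (1)]
[folklore] -/
theorem of_sub_of_mem_fibredRelations_of_eqOn {r r' : IntegralRep n} (hd : r'.domain = r.domain)
    (h : EqOn r.integrand r'.integrand r.domain) : of r - of r' ∈ fibredRelations := by
  obtain ⟨z, hzd, hzi⟩ := exists_zeroRep r.isSemialgebraic_domain
  have h1 : of r - of r' - of z ∈ integrandAddRel :=
    ⟨n, r, r', z, hd, hzd, fun x hx => by simp [hzi, h hx], rfl⟩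
  have h2 : of z ∈ fibredRelations := of_mem_fibredRelations_of_eqOn_zero z (by simp [hzi, EqOn])
  have : of r - of r' = (of r - of r' - of z) + of z := by abel
  rw [this]
  exact fibredRelations.add_mem (mem_fibredRelations_of_mem_integrandAddRel h1) h2

/-- **Splitting off a null piece is a fibred move**: if `E ⊆ σ` is `ℚ`-semialgebraic and `σ ∖ E`
is null then `[σ, f] − [E, f] ∈ fibredRelations` (domain additivity `σ = E ∪ (σ ∖ E)`, the null
piece being a fibred relation). [Kontsevich–Zagier 2001, §1.2, rule (1)] [folklore] -/
theorem of_sub_of_restrict_mem_fibredRelations (r : IntegralRep n) {E : Set (Fin n → ℝ)}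
    (hE : IsSemialgebraic ℚ E) (hEr : E ⊆ r.domain) (hvol : volume (r.domain \ E) = 0) :
    of r - of (r.restrict E hE hEr) ∈ fibredRelations := by
  have hdiff : IsSemialgebraic ℚ (r.domain \ E) := r.isSemialgebraic_domain.diff hE
  have hsub : r.domain \ E ⊆ r.domain := fun _ hx => hx.1
  have hdom : r.domain =
      (r.restrict E hE hEr).domain ∪ (r.restrict (r.domain \ E) hdiff hsub).domain := by
    simp [union_sdiff_cancel hEr]
  have hadd : of r - of (r.restrict E hE hEr) -
      of (r.restrict (r.domain \ E) hdiff hsub) ∈ domainAddRel :=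
    ⟨n, r, r.restrict E hE hEr, r.restrict (r.domain \ E) hdiff hsub, hdom,
      by simp, fun _ _ => rfl, fun _ _ => rfl, rfl⟩
  have hN : of (r.restrict (r.domain \ E) hdiff hsub) ∈ fibredRelations :=
    of_mem_fibredRelations_of_volume_eq_zero _ hvol
  have := fibredRelations.add_mem (mem_fibredRelations_of_mem_domainAddRel hadd) hN
  simpa using this

/-- **Splitting a domain in two is a fibred move**: if `σ = A ∪ B` with `A`, `B` `ℚ`-semialgebraic
and `A ∩ B` null, then `[σ, f] − [A, f] − [B, f] ∈ fibredRelations`.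
[Kontsevich–Zagier 2001, §1.2, rule (1)] [folklore] -/
theorem of_sub_of_restrict_sub_of_restrict_mem_fibredRelations (r : IntegralRep n)
    {A B : Set (Fin n → ℝ)} (hA : IsSemialgebraic ℚ A) (hB : IsSemialgebraic ℚ B)
    (hAB : r.domain = A ∪ B) (hnull : volume (A ∩ B) = 0) :
    of r - of (r.restrict A hA (hAB ▸ subset_union_left)) -
      of (r.restrict B hB (hAB ▸ subset_union_right)) ∈ fibredRelations :=
  mem_fibredRelations_of_mem_domainAddRel
    ⟨n, r, r.restrict A hA (hAB ▸ subset_union_left), r.restrict B hB (hAB ▸ subset_union_right),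
      by simpa using hAB, by simpa using hnull, fun _ _ => rfl, fun _ _ => rfl, rfl⟩

/-! ### Families away from `s = 0⁺` are dominated -/

/-- **A family whose domain avoids the slab `{0 < z 0 < ε}` is dominated**, by the empty
representation and with empty special fibre: clause (1) is vacuous, clause (2) holds for every
fibre point `x` because `(s, x)` is not in the domain for `0 < s < ε`, clause (3) is vacuous.
[folklore] -/
theorem isDominatedFamily_empty_of_forall_not {S : IntegralRep (n + 1)} {ε : ℝ} (hε : 0 < ε)
    (h : ∀ z ∈ S.domain, ¬ (0 < z 0 ∧ z 0 < ε)) :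
    IsDominatedFamily S (IntegralRep.empty n) (IntegralRep.empty n) := by
  refine ⟨⟨ε, hε, fun z hz h0 hzε => (h z hz ⟨h0, hzε⟩).elim⟩, ?_, ?_⟩
  · refine Eventually.of_forall fun x => ?_
    filter_upwards [Ioo_mem_nhdsGT hε] with s hs
    simp only [IntegralRep.domain_empty, mem_empty_iff_false, iff_false]
    exact fun hmem => h _ hmem ⟨by simpa using hs.1, by simpa using hs.2⟩
  · exact Eventually.of_forall fun x hx => (by simp at hx)

/-- **The complement of a slab restriction is dominated**: for rational `ε > 0`, the restriction of
a family `R` to `R.domain ∖ {0 < z 0 < ε}` (`KZ.IntegralRep.slabCompl R 0 ε`) is a dominated family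
(empty envelope, empty special fibre). [folklore] -/
theorem isDominatedFamily_slabCompl (R : IntegralRep (n + 1)) {ε : ℚ} (hε : 0 < ε) :
    IsDominatedFamily (R.slabCompl 0 ε) (IntegralRep.empty n) (IntegralRep.empty n) := by
  refine isDominatedFamily_empty_of_forall_not (show (0 : ℝ) < ε by exact_mod_cast hε) fun z hz h => ?_
  exact hz.2 (mem_paramSlab.mpr ⟨by exact_mod_cast h.1, h.2⟩)

/-- **Cutting a family at `s = ε`**: `[R] − [R|{0 < z 0 < ε}] − [R|∁] ∈ fibredRelations` with the
second piece dominated; the form in which the reduction to families over `(0, ε)` is consumed.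
[Kontsevich–Zagier 2001, §1.2, rule (1)] [folklore] -/
theorem of_sub_of_slabRestrict_sub_mem_fibredRelations (R : IntegralRep (n + 1)) (ε : ℚ) :
    of R - of (R.slabRestrict 0 ε) - of (R.slabCompl 0 ε) ∈ fibredRelations :=
  mem_fibredRelations_of_mem_domainAddRel (R.of_sub_of_slabRestrict_sub_of_slabCompl_mem 0 ε)

end Summit.KontsevichZagierPeriods.ValuedFieldSpecialisation
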